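import Literature.Computability.Cryptography.StatisticalDistanceISupMeasure
import Literature.Computability.Cryptography.StatisticalDistanceProofs
import HarnessLib

/-!
# Statistical distance: events and mixtures

Layer `Literature/Computability/Cryptography`, theorems-only companion of `StatisticalDistance.lean`
(`PMF.tvDist`) and `StatisticalDistanceISupMeasure.lean` (`PMF.tvDist_eq_iSup_measure_holds`:
`Δ(p, q) = sup_S (p S − q S)`). Two standard consequences, in the form consumed by simulation
arguments that condition on a "good" event of their internal randomness (e.g. Aaronson–Chen 2017,
proof of Lemma 8.2: "with probability at least `1 − ε/2` … `‖𝒟 − 𝒟^M_{x,ε}‖ ≤ ε/2`. Hence the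
outputted distribution satisfies `‖𝒟^A_{x,ε} − 𝒟^M_{x,ε}‖ ≤ ε`", p. 33):

* `PMF.toReal_toOuterMeasure_sub_le_tvDist`, `PMF.abs_toReal_toOuterMeasure_sub_le_tvDist` —
  every event's probabilities differ by at most the statistical distance,
  `|p S − q S| ≤ Δ(p, q)` (Goldreich 2001, §3.8.4 Exercise 5: `Δ = max_S Δ_S`);
* `PMF.tvDist_bind_right_le` — **convexity in one argument**: against a mixture
  `μ.bind f = ∑_ω μ(ω) f_ω` one has `Δ(p, ∑_ω μ(ω) f_ω) ≤ ∑_ω μ(ω) Δ(p, f_ω)`;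
* `PMF.tvDist_bind_right_le_of_good` — hence, if `Δ(p, f_ω) ≤ δ` on an event `G` of `μ`-probability
  at least `1 − β`, then `Δ(p, μ.bind f) ≤ β + δ` ("bad event costs its probability, good event
  its distance").

## References

* O. Goldreich, *Foundations of Cryptography I*, CUP 2001, §3.2.2 Eq. (3.1), §3.8.4 Exercise 5
  [Goldreich2001].
* S. Aaronson, L. Chen, CCC 2017 (arXiv:1612.05903), proof of Lemma 8.2 (p. 33), as a consumer
  [AaronsonChen2017].
-/

open scoped ENNReal

namespace PMF

variable {α Ω : Type*}

/-! ### Events -/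

/-- The event differences `p S − q S` are bounded above (by `1`). [folklore] -/
theorem bddAbove_range_toReal_sub (p q : PMF α) :
    BddAbove (Set.range fun S : Set α => (p.toOuterMeasure S).toReal - (q.toOuterMeasure S).toReal) := by
  refine ⟨1, ?_⟩
  rintro _ ⟨S, rfl⟩
  have h1 : (p.toOuterMeasure S).toReal ≤ 1 :=
    ENNReal.toReal_le_of_le_ofReal zero_le_one (by
      rw [ENNReal.ofReal_one]
      exact (p.toOuterMeasure_mono (fun _ _ => Set.mem_univ _)).trans_eq
        ((p.toOuterMeasure_apply_eq_one_iff Set.univ).2 (Set.subset_univ _)))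
  have h2 : 0 ≤ (q.toOuterMeasure S).toReal := ENNReal.toReal_nonneg
  linarith

/-- **Every event moves by at most the statistical distance** (signed form):
`p S − q S ≤ Δ(p, q)`. Dot-notation extension of Mathlib's `PMF` namespace, next to
`tvDist_eq_iSup_measure_holds`. [cite: Goldreich2001, §3.8.4 Exercise 5] -/
theorem toReal_toOuterMeasure_sub_le_tvDist (p q : PMF α) (S : Set α) :
    (p.toOuterMeasure S).toReal - (q.toOuterMeasure S).toReal ≤ p.tvDist q := by
  rw [tvDist_eq_iSup_measure_holds p q]
  exact le_ciSup (bddAbove_range_toReal_sub p q) S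

/-- **Every event moves by at most the statistical distance**: `|p S − q S| ≤ Δ(p, q)`.
Dot-notation extension of Mathlib's `PMF` namespace. [cite: Goldreich2001, §3.8.4 Exercise 5] -/
theorem abs_toReal_toOuterMeasure_sub_le_tvDist (p q : PMF α) (S : Set α) :
    |(p.toOuterMeasure S).toReal - (q.toOuterMeasure S).toReal| ≤ p.tvDist q := by
  rw [abs_le]
  refine ⟨?_, toReal_toOuterMeasure_sub_le_tvDist p q S⟩
  have h := toReal_toOuterMeasure_sub_le_tvDist q p S
  rw [tvDist_comm] at h
  linarith

/-! ### Mixtures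

The elementary facts `∑' ω, (μ ω).toReal = 1` and `Summable fun ω => (μ ω).toReal` are
`PMF.tsum_coe_toReal` / `PMF.summable_coe_toReal` of `StatisticalDistanceProofs.lean` (reused, not
restated). -/

/-- Weighted by the point masses of a `PMF`, any family bounded by `1` in absolute value is
summable. [folklore] -/
theorem summable_toReal_mul_of_abs_le_one (μ : PMF Ω) {g : Ω → ℝ} (hg : ∀ ω, |g ω| ≤ 1) :
    Summable fun ω => (μ ω).toReal * g ω := by
  refine (summable_coe_toReal μ).of_norm_bounded (fun ω => ?_)
  rw [Real.norm_eq_abs, abs_mul, abs_of_nonneg ENNReal.toReal_nonneg]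
  exact mul_le_of_le_one_right ENNReal.toReal_nonneg (hg ω)

/-- The probability of an event under a mixture, as a real number:
`(μ.bind f)(S) = ∑_ω μ(ω) · f_ω(S)`. [folklore] -/
theorem toReal_toOuterMeasure_bind_apply (μ : PMF Ω) (f : Ω → PMF α) (S : Set α) :
    ((μ.bind f).toOuterMeasure S).toReal = ∑' ω, (μ ω).toReal * ((f ω).toOuterMeasure S).toReal := by
  rw [toOuterMeasure_bind_apply, ENNReal.tsum_toReal_eq (fun ω => ?_)]
  · exact tsum_congr fun ω => ENNReal.toReal_mul
  · refine ENNReal.mul_ne_top (μ.apply_ne_top ω) (ne_top_of_le_ne_top ENNReal.one_ne_top ?_)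
    exact ((f ω).toOuterMeasure_mono (fun _ _ => Set.mem_univ _)).trans_eq
      (((f ω).toOuterMeasure_apply_eq_one_iff Set.univ).2 (Set.subset_univ _))

/-- A probability, as a real number, is at most `1`. [folklore] -/
theorem toReal_toOuterMeasure_le_one (p : PMF α) (S : Set α) : (p.toOuterMeasure S).toReal ≤ 1 :=
  ENNReal.toReal_le_of_le_ofReal zero_le_one (by
    rw [ENNReal.ofReal_one]
    exact (p.toOuterMeasure_mono (fun _ _ => Set.mem_univ _)).trans_eq
      ((p.toOuterMeasure_apply_eq_one_iff Set.univ).2 (Set.subset_univ _)))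

/-- **Statistical distance is convex in its second argument**: for a mixture
`μ.bind f = ∑_ω μ(ω) f_ω`, `Δ(p, μ.bind f) ≤ ∑_ω μ(ω) Δ(p, f_ω)` — for every event `S`,
`p S − ∑_ω μ(ω) f_ω S = ∑_ω μ(ω) (p S − f_ω S) ≤ ∑_ω μ(ω) Δ(p, f_ω)`, then take the supremum
(`tvDist_eq_iSup_measure_holds`). Dot-notation extension of Mathlib's `PMF` namespace.
[cite: Goldreich2001, §3.2.2 Eq. (3.1) with §3.8.4 Exercise 5] -/
theorem tvDist_bind_right_le (p : PMF α) (μ : PMF Ω) (f : Ω → PMF α) :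
    p.tvDist (μ.bind f) ≤ ∑' ω, (μ ω).toReal * p.tvDist (f ω) := by
  rw [tvDist_eq_iSup_measure_holds]
  refine ciSup_le fun S => ?_
  have hsumm1 : Summable fun ω => (μ ω).toReal * ((f ω).toOuterMeasure S).toReal :=
    summable_toReal_mul_of_abs_le_one μ fun ω => by
      rw [abs_of_nonneg ENNReal.toReal_nonneg]; exact toReal_toOuterMeasure_le_one _ _
  have hsumm2 : Summable fun ω => (μ ω).toReal * p.tvDist (f ω) :=
    summable_toReal_mul_of_abs_le_one μ fun ω => by
      rw [abs_of_nonneg (tvDist_nonneg _ _)]; exact tvDist_le_one_holds _ _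
  have hp : (p.toOuterMeasure S).toReal = ∑' ω, (μ ω).toReal * (p.toOuterMeasure S).toReal := by
    rw [tsum_mul_right, tsum_coe_toReal, one_mul]
  rw [toReal_toOuterMeasure_bind_apply, hp, ← ((summable_coe_toReal μ).mul_right _).tsum_sub hsumm1]
  refine (((summable_coe_toReal μ).mul_right _).sub hsumm1).tsum_le_tsum (fun ω => ?_) hsumm2
  rw [← mul_sub]
  exact mul_le_mul_of_nonneg_left (toReal_toOuterMeasure_sub_le_tvDist p (f ω) S) ENNReal.toReal_nonneg

/-- **Conditioning on a good event**: if `Δ(p, f_ω) ≤ δ` for all `ω` in an event `G` with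
`μ(Gᶜ) ≤ β` (and `0 ≤ δ`), then `Δ(p, μ.bind f) ≤ β + δ` — the bad event costs at most its
probability (`Δ ≤ 1`), the good one at most `δ`. Dot-notation extension of Mathlib's `PMF`
namespace. [cite: AaronsonChen2017, §8 (proof of Lemma 8.2, "with probability at least 1 − ε/2 … Hence … ≤ ε", p. 33)] -/
theorem tvDist_bind_right_le_of_good (p : PMF α) (μ : PMF Ω) (f : Ω → PMF α) (G : Set Ω)
    {β δ : ℝ} (hδ : 0 ≤ δ) (hbad : (μ.toOuterMeasure Gᶜ).toReal ≤ β)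
    (hgood : ∀ ω ∈ G, p.tvDist (f ω) ≤ δ) : p.tvDist (μ.bind f) ≤ β + δ := by
  classical
  refine (tvDist_bind_right_le p μ f).trans ?_
  have hsumm : Summable fun ω => (μ ω).toReal * p.tvDist (f ω) :=
    summable_toReal_mul_of_abs_le_one μ fun ω => by
      rw [abs_of_nonneg (tvDist_nonneg _ _)]; exact tvDist_le_one_holds _ _
  -- pointwise: μ ω Δ(p, f ω) ≤ μ ω (𝟙_{Gᶜ} ω + δ)
  have hpt : ∀ ω, (μ ω).toReal * p.tvDist (f ω) ≤
      Gᶜ.indicator (fun ω => (μ ω).toReal) ω + (μ ω).toReal * δ := by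
    intro ω
    by_cases hω : ω ∈ G
    · rw [Set.indicator_of_notMem (show ω ∉ Gᶜ from fun h => h hω), zero_add]
      exact mul_le_mul_of_nonneg_left (hgood ω hω) ENNReal.toReal_nonneg
    · rw [Set.indicator_of_mem (show ω ∈ Gᶜ from hω)]
      have h1 : p.tvDist (f ω) ≤ 1 := tvDist_le_one_holds _ _
      nlinarith [ENNReal.toReal_nonneg (a := μ ω), tvDist_nonneg p (f ω)]
  have hind : Summable (Gᶜ.indicator fun ω => (μ ω).toReal) := (summable_coe_toReal μ).indicator _
  have hδs : Summable fun ω => (μ ω).toReal * δ := (summable_coe_toReal μ).mul_right _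
  calc ∑' ω, (μ ω).toReal * p.tvDist (f ω)
      ≤ ∑' ω, (Gᶜ.indicator (fun ω => (μ ω).toReal) ω + (μ ω).toReal * δ) :=
        hsumm.tsum_le_tsum hpt (hind.add hδs)
    _ = (μ.toOuterMeasure Gᶜ).toReal + δ := by
        rw [hind.tsum_add hδs, toReal_toOuterMeasure_apply, tsum_mul_right, tsum_coe_toReal, one_mul]
    _ ≤ β + δ := by linarith

end PMF
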